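import Mathlib
import HarnessLib
import Summits.QuantumFields.YangMills.Theses.ScalingWindowSplit
import Summits.QuantumFields.YangMills.Theorems.MirrorModularBoostsHypercubicLimitCouplingResponseDefsC
import Summits.QuantumFields.YangMills.Theorems.ScalingWindowSplitSelfNormalisedMomentBoundsRStubPlaneMean
import Summits.QuantumFields.YangMills.Theorems.ScalingWindowSplitSelfNormalisedMomentBoundsRStubEventually
import Summits.QuantumFields.YangMills.Theorems.ScalingWindowSplitSelfNormalisedMomentBoundsRStubFlatPoint
import Summits.QuantumFields.YangMills.Theorems.ScalingWindowSplitSelfNormalisedMomentBoundsRStubRiemannBound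
import Summits.QuantumFields.YangMills.Theorems.ScalingWindowSplitSelfNormalisedMomentBoundsRStubAssembly

/-!
# Crux `SelfNormalisedMomentBoundsR` (stmt-QuantumFields-18014) — line `Sketch`: the crux FROM the cluster bound

The composition of line `Sketch` made unconditional in everything but the physics: `SelfNormalisedMomentBoundsR`
(U_R, route `ScalingWindowSplit`) FOLLOWS from the functional-graph cluster bound alone —
`selfNormalisedMomentBoundsR_of_clusterBound : ClusterBound → U_R`, sorry-free over the eight landed stubs of the
line (`stub_planeMean` p159510, `stub_eventually` p159318, `stub_flatPoint` p159056, `stub_riemannBound` p159357,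
`stub_expansion` p160824, `stub_vertexBound` p160942, `stub_riemannSqrt` p160617, `stub_assembly` p161368).

`ClusterBound` (the hypothesis, stated inline; it is the registered stub `stub_clusterBound` of the line, verbatim):
along every admissible datum `(G, r, sch, u, p, M)` of U_R there are `C ≥ 1`, `k₀` with, for `k ≥ k₀`, `n ≥ 2`,
injective box sites `x` and planes `q`,
`|c'_kⁿ ∫ ∏ᵢ (O_{qᵢ}(τ_{xᵢ}Ũ) − m'_k/6) dμ_k| ≤ Cⁿ Σ_{f : [n]→[n] fixed-point-free} ∏ᵢ (a_k d_torus(xᵢ, x_{f i}))⁻⁴`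
for the SELF-NORMALISED scheme (`c'_k = 1/√T⁰_k(u,θu)`, `m'_k` = torus mean of the action density).  It is the
ultraviolet kernel K_UV in cluster-expansion OUTPUT format; like U_R itself it is expected for compact SIMPLE `G` and
refuted modulo (P1)+(P2) for `U(1) × SU(2)` (census §1) — so this theorem is the exact residue of the crux BY NAME.

Consequence (recorded in the crux workfile `Lines/Sketch_RS.lean`, which may import the census module): with the
census's `selfNormalisedMomentBoundsR_false_of_twoRateHonestWindowScheme`, `TwoRateHonestWindowScheme → ¬ClusterBound`.
References: Glimm–Jaffe (1987) §18; Osterwalder–Schrader II (1975) §2.  No definitions, no named facts.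
-/

noncomputable section

open scoped SchwartzMap BigOperators Topology
open MeasureTheory Filter Topology
open Literature.MathematicalPhysics.AQFT Literature.MathematicalPhysics.QuantumLattice
open Literature.MathematicalPhysics.QuantumFieldTheory Literature.Probability.LatticeModels
open Summit.QuantumFields.YangMills.Cruxes.HypercubicLimit.CouplingResponse

namespace Summit.QuantumFields.YangMills.Theorems.ScalingWindowSplit.SelfNormalisedMomentBoundsR

/-- **U_R from the cluster bound (line `Sketch`, composition made a theorem).**  If the functional-graph cluster
bound holds at every admissible datum of the crux (the registered physics stub `stub_clusterBound`, taken here as a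
hypothesis), then `SelfNormalisedMomentBoundsR` holds: fix a datum; the conclusion is `UniformMomentBoundsPlanes r canon`
by `Iff.rfl`; the hypothesis gives `(C, k₀)`; polynomial volumes give `N` and `stub_assembly N` (fed `stub_flatPoint`,
`stub_riemannBound`) gives `(s, K)`; beyond `k₀` and the eventualities `a_k ≤ 1`, `a_k L_k ≥ 1`, `a_k⁻¹ ≤ (a_k L_k)^N`
the assembly (with `stub_planeMean` for the torus-mean-centred `canon`) bounds the moments by `K (K C)ⁿ n!`, and
`stub_eventually` removes the threshold. [folklore] -/
theorem selfNormalisedMomentBoundsR_of_clusterBound :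
    (
    ∀ (G : Type) [Group G] [TopologicalSpace G] [IsTopologicalGroup G] [CompactSpace G] [MeasurableSpace G]
      [BorelSpace G] (r : LatticeRep G) (sch : SpeciesScheme (YMSpecies G)) (u : 𝓢(EuclideanSpace ℝ (Fin 4), ℝ))
      (p : ℕ) (M : ℝ),
      let bare : SpeciesScheme (YMSpecies G) := { sch with c := fun _ _ => 1, m := fun _ _ => 0 }
      let T : 𝓢(EuclideanSpace ℝ (Fin 4), ℝ) → ℕ → ℝ := fun w k =>
        latticeSchwinger r.ρ bare (fun s => s.F) k (1 + 1) (fun _ => r.curvature) ![w, thetaTest 4 w] -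
          latticeSchwinger r.ρ bare (fun s => s.F) k 1 (fun _ => r.curvature) ![w] *
            latticeSchwinger r.ρ bare (fun s => s.F) k 1 (fun _ => r.curvature) ![thetaTest 4 w]
      let canon : SpeciesScheme (YMSpecies G) :=
        { sch with
          c := fun _ k => (Real.sqrt (T u k))⁻¹
          m := fun _ k => ∫ U, r.curvature.F (torusLift (sch.side k) U) ∂(wilsonMeasure r.ρ (sch.β k)) }
      sch.HasWeakCouplingLimit →
      (∃ N : ℕ, 1 ≤ N ∧ ∀ᶠ k in atTop, (sch.a k)⁻¹ ≤ (sch.a k * (sch.L k : ℝ)) ^ N) →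
      tsupport u ⊆ {y : EuclideanSpace ℝ (Fin 4) | y 0 < 0} →
      (∀ᶠ k in atTop, (sch.a k) ^ p ≤ T u k ∧ T u k ≤ M * T (timeShiftTest 4 (-1) u) k) →
      ∃ (C : ℝ) (k₀ : ℕ), 1 ≤ C ∧ ∀ k : ℕ, k₀ ≤ k →
        ∀ (n : ℕ) (x : Fin n → Site 4) (q : Fin n → Plane), 2 ≤ n → Function.Injective x →
          (∀ i, x i ∈ box 4 (canon.L k)) →
          |canon.c r.curvature k ^ n *
              ∫ U, ∏ i, ((planeSpecies r (q i)).F (configShift (-(x i)) (torusLift (canon.side k) U)) -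
                canon.m r.curvature k / 6) ∂(wilsonAt r canon k)| ≤
            C ^ n * ∑ f : Fin n → Fin n, (if ∀ i, f i ≠ i then
              ∏ i, ((canon.a k * ‖siteToE (fun μ : Fin 4 =>
                ((((x i μ - x (f i) μ : ℤ) : ZMod (canon.side k)).valMinAbs : ℤ)))‖)⁻¹) ^ 4 else 0)) →
    Summit.QuantumFields.YangMills.Theses.ScalingWindowSplit.SelfNormalisedMomentBoundsR := by
  intro hcb G _ _ _ _ _ _ r sch u p M bare T canon hw hpv hu hfw
  show UniformMomentBoundsPlanes r canon
  -- the physics stub at the datum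
  obtain ⟨C, k₀, hC1, hcl⟩ := hcb G r sch u p M hw hpv hu hfw
  -- the volume exponent and the assembly constants
  obtain ⟨N, -, hpvN⟩ := hpv
  obtain ⟨s, K, hK, hassem⟩ := stub_assembly stub_flatPoint stub_riemannBound N
  -- the eventualities of the scheme: `a_k ≤ 1`, `a_k L_k ≥ 1`, polynomial volumes
  have ha1 : ∀ᶠ k in atTop, sch.a k ≤ 1 :=
    (sch.tendsto_a.eventually (Iic_mem_nhds (zero_lt_one' ℝ))).mono fun k hk => hk
  have haL : ∀ᶠ k in atTop, 1 ≤ sch.a k * (sch.L k : ℝ) := sch.tendsto_L.eventually_ge_atTop 1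
  obtain ⟨k₁, hk₁⟩ := (ha1.and (haL.and hpvN)).exists_forall_of_atTop
  -- the one-point identity for `canon` (its counterterm IS the torus mean)
  have h1 : ∀ k (q : Plane) (f : 𝓢(EuclideanSpace ℝ (Fin 4), ℝ)),
      ∫ U, planeField r canon k q f U ∂(wilsonAt r canon k) = 0 :=
    fun k => stub_planeMean G r canon k rfl
  -- assemble on the tail `k ≥ max k₀ k₁`
  refine stub_eventually G r canon ⟨s, max k₀ k₁, K, K * C, fun n F hF hD k hk => ?_⟩
  have hk0 : k₀ ≤ k := (le_max_left _ _).trans hk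
  obtain ⟨hak, haLk, hpvk⟩ := hk₁ k ((le_max_right _ _).trans hk)
  exact hassem G r canon k C hC1 hak haLk hpvk (h1 k) (hcl k hk0) n F hF hD

end Summit.QuantumFields.YangMills.Theorems.ScalingWindowSplit.SelfNormalisedMomentBoundsR

end
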